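import Summits.NavierStokesRegularity.NavierStokesRegularity.Theorems.QuietScarPocketDoorDefs

/-!
# QuietScarPocketDoorDoor — door S31 «QuietScarPocketDoor» (nsreg-p1 g25 ROUND-29 v2.1, texts `r29/Sketch31.lean` 363b5766493b6c28,
# sealed ref3 g24; Defs = `Theorems/QuietScarPocketDoorDefs.lean`): THE COMPOSITIONS (Sketch31 §3, verbatim)

* `pvScarPocketRegularity_of : ScarPocketZoom → TerminalTraceAnalytic → TracelessScarLiouville → PVScarPocketRegularity` — by
  contradiction: K1 (class zoom at the pocket scale) delivers a backward-singular slab profile with a continuous off-apex representative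
  whose top curl trace `Ω₀` vanishes on the pocket `B(e,κ)`; LEG F makes `Ω₀` real-analytic on `ℝ³∖{0}`, the identity theorem
  (`trace_eq_zero_of_pocket`, Defs) kills it everywhere off the apex, so the curl fades at the top near every point of the half-space
  `{⟪x,e⟫ > 0}`, and K2 (tree: ESS half-space backward uniqueness + strip Liouville, `tracelessScarLiouville_holds`) forbids the
  singular origin.
* `pvScarPocketRegularity_of_local` — the same with the local physical form of LEG F.
* `targetScarPocket_of : ScarPocketZoom → TerminalTraceAnalytic → FrameTransferS31 → TargetScarPocket` — physical frame.

Door S31 is a regularity CRITERION about the terminal vorticity trace of a HYPOTHETICAL one-point Type-I blow-up; item 0056 `NoTypeII`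
and NS regularity are NOT proved and stay OPEN.
-/

noncomputable section

set_option linter.dupNamespace false

namespace Summit.NavierStokesRegularity.NavierStokesRegularity.Theorems.QuietScarPocketDoor

open MeasureTheory Set Function Filter Topology TopologicalSpace Metric
open scoped RealInnerProductSpace Topology
open Literature.Analysis Literature.Analysis.FluidPDE

/-- **COMPOSITION (door S31, Pineau–Vicol frame):** K1 (class zoom) + LEG F (terminal-trace analyticity) + K2 (traceless scar
Liouville, tree) ⇒ the door — by contradiction: the limit's top trace `Ω₀` is analytic on `ℝ³∖{0}` and vanishes on the
pocket, hence everywhere off the apex (identity theorem), so the representative's curl fades at the top near every point of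
the half-space `{⟪x,e⟫ > 0}`, and K2 forbids the singular origin delivered by K1. -/
theorem pvScarPocketRegularity_of (hZ : ScarPocketZoom) (hF : TerminalTraceAnalytic) (hL : TracelessScarLiouville) :
    PVScarPocketRegularity := by
  intro Cu hCu κ hκ hκ1
  by_contra hdoor
  obtain ⟨w, π, H, C, e, Uc, Ω₀, hsw, hwg, hI, hapex, he, hsing, hUc, hUcc, hcl, hΩc, htop, hpocket⟩ :=
    hZ Cu hCu κ hκ hκ1 hdoor
  -- LEG F + identity theorem: the top trace vanishes off the apex
  have hΩa : AnalyticOnNhd ℝ Ω₀ ({0}ᶜ : Set (EuclideanSpace ℝ (Fin 3))) := hF C Uc Ω₀ hcl htop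
  have hΩ0 : EqOn Ω₀ 0 ({0}ᶜ : Set (EuclideanSpace ℝ (Fin 3))) := trace_eq_zero_of_pocket hΩa he hκ hκ1 hpocket
  -- restriction of the representative to the half-space `{⟪x,e⟫ > 0} ⊆ ℝ³∖{0}`
  have hhalf : {x : EuclideanSpace ℝ (Fin 3) | 0 < ⟪x, e⟫} ⊆ ({0}ᶜ : Set (EuclideanSpace ℝ (Fin 3))) := by
    intro x hx h0
    have hx' : (0 : ℝ) < ⟪x, e⟫ := hx
    rw [mem_singleton_iff.1 h0, inner_zero_left] at hx'
    exact lt_irrefl 0 hx'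
  have hsub : Ioo (-1 : ℝ) 0 ×ˢ {x : EuclideanSpace ℝ (Fin 3) | 0 < ⟪x, e⟫} ⊆
      Ioo (-1 : ℝ) 0 ×ˢ ({0}ᶜ : Set (EuclideanSpace ℝ (Fin 3))) :=
    prod_mono Subset.rfl hhalf
  have hUc' : uncurry Uc =ᵐ[volume.restrict (Ioo (-1 : ℝ) 0 ×ˢ {x : EuclideanSpace ℝ (Fin 3) | 0 < ⟪x, e⟫})]
      uncurry w :=
    ae_restrict_of_ae_restrict_of_subset hsub hUc
  have hUcc' : ContinuousOn (uncurry Uc) (Ioo (-1 : ℝ) 0 ×ˢ {x : EuclideanSpace ℝ (Fin 3) | 0 < ⟪x, e⟫}) :=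
    hUcc.mono hsub
  -- top fading of the curl on the half-space, from `TopCurlTendsto` and `Ω₀ ≡ 0`
  have htopc : ∀ x₁ : EuclideanSpace ℝ (Fin 3), 0 < ⟪x₁, e⟫ → ∀ θ : ℝ, 0 < θ → ∃ s₀ δ : ℝ, s₀ < 0 ∧ (-1 : ℝ) ≤ s₀ ∧
      0 < δ ∧ ∀ s ∈ Ioo s₀ 0, ∀ x ∈ ball x₁ δ, ‖curl (Uc s) x‖ ≤ θ := by
    intro x₁ hx₁ θ hθ
    have hx₁0 : x₁ ≠ 0 := fun h => hhalf hx₁ (mem_singleton_iff.2 h)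
    -- shrink the ball so that it stays off the apex
    obtain ⟨s₀, δ, hs₀, hs₁, hδ, hconv⟩ := htop x₁ hx₁0 θ hθ
    have hn : 0 < ‖x₁‖ := norm_pos_iff.2 hx₁0
    refine ⟨s₀, min δ (‖x₁‖ / 2), hs₀, hs₁, lt_min hδ (by linarith), fun s hs x hx => ?_⟩
    have hxδ : x ∈ ball x₁ δ := ball_subset_ball (min_le_left _ _) hx
    have hx0 : x ∈ ({0}ᶜ : Set (EuclideanSpace ℝ (Fin 3))) := by
      intro h0
      rw [mem_singleton_iff.1 h0, mem_ball, dist_zero_left] at hx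
      linarith [min_le_right δ (‖x₁‖ / 2)]
    have h1 := hconv s hs x hxδ
    have h2 : Ω₀ x = 0 := hΩ0 hx0
    simpa [h2] using h1
  exact hL w π H hsw hwg hI C hapex e he Uc hUc' hUcc' htopc hsing

/-- **COMPOSITION with the local form of LEG F.** -/
theorem pvScarPocketRegularity_of_local (hZ : ScarPocketZoom) (hF : TerminalSliceAnalyticity)
    (hFl : TerminalTraceAnalyticOfLocal) (hL : TracelessScarLiouville) : PVScarPocketRegularity :=
  pvScarPocketRegularity_of hZ (hFl hF) hL

/-- **COMPOSITION (door S31, physical frame):** with the frame transfer; K2 discharged by the tree. -/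
theorem targetScarPocket_of (hZ : ScarPocketZoom) (hF : TerminalTraceAnalytic) (hT : FrameTransferS31) :
    TargetScarPocket :=
  hT (pvScarPocketRegularity_of hZ hF tracelessScarLiouville_holds)

end Summit.NavierStokesRegularity.NavierStokesRegularity.Theorems.QuietScarPocketDoor

end
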